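import Literature.NumberTheory.Automorphic.HenniartAutomorphicInductionProofs
import Literature.NumberTheory.Automorphic.AutomorphicInductionNormTwist
import Literature.NumberTheory.Automorphic.AlgebraicityTwist
import HarnessLib

/-!
# Henniart's archimedean statement is invariant under the twists `⊗ |det|^s`
(the unitary-normalisation step of the printed proof, formalised)

Topic `NumberTheory/Automorphic`; theorems only. The named fact
`Henniart2012_infinityType_of_automorphicInduction` (`HenniartAutomorphicInduction`) is stated
for all cuspidal `P` on `GL_{dn}(𝔸_K)` and `π` on `GL_n(𝔸_L)`, while Henniart 2012 (§1.18:
"Les représentations automorphes que nous considérons sont en général unitaires") works with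
unitary ones; the module docstring of the fact explains the reduction: twist both by `|det|^s`
("the only step not printed"). This file proves that reduction step in the tree's datum model:
for real `s` and the Borel–Jacquet twists `P' = P ⊗ |det|_{𝔸_K}^s`, `π' = π ⊗ |det|_{𝔸_L}^s`
(`AutomorphicTwistNorm`), **the instance of Henniart's statement for `(P, π)` is equivalent to
its instance for `(P', π')`**:

* the hypothesis (Arthur–Clozel Def. 6.1 / Henniart (1.1) a.e.) transfers
  (`IsAutomorphicInductionAlong.of_normTwist`, file `AutomorphicInductionNormTwist`:
  `t ↦ q^{-s} t` on both sides, `q_w = q_v^{f(w|v)}`);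
* infinity types transfer, `T ↦ T.twist s`
  (`AutomorphicRepData.HasInfinityType.of_map_mulChar_detTwist`, file `ArchParameterTwistNorm`:
  the archimedean parameter of `π ⊗ |det|^s` is `χ_π + s`);
* and the identity `(T_P σ).map a = ∑_{σ' ∣ σ} (T_π σ').map a` is invariant under shifting all
  exponents by `s` (`map_a_eq_sum_iff_twist`: both sides are shifted by `s`, `d` extensions
  `σ' ∣ σ` on the right, `dn` entries on the left).

So Henniart's fact may be checked after any common real twist of `P` and `π`, e.g. the one making
`π` (or `P`) unitary / trivial on `A_G` (Borel–Jacquet 1979, 5.7).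

## References

* G. Henniart, Bull. SMF 140 (2012) 1–17, §1.10, §1.18. [Henniart2012]
* A. Borel, H. Jacquet, Corvallis 1979, 5.7. [BorelJacquet1979]
* J. Arthur, L. Clozel (1989), Ch. 3, proof of Thm. 3.1 ("We may assume `π, π'` unitary").
  [ArthurClozelAMS120]
-/

noncomputable section

open scoped NumberField Classical
open NumberField IsDedekindDomain Literature.NumberTheory.Automorphic

namespace Literature.NumberTheory.Automorphic

open Literature.NumberTheory.GaloisRepresentations (HeckeCharacter ideleGroup)

/-! ### Bookkeeping: the identity is invariant under a common shift of the exponents -/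

section Shift

variable {K : Type} [Field K] {L : Type} [Field L] [Algebra K L] {N n : ℕ}

/-- A sum of mapped multisets is the mapped sum (`Multiset.map` is additive). [folklore] -/
theorem sum_map_eq_map_sum {ι : Type*} (S : Finset ι) (f : ι → Multiset ℂ) (g : ℂ → ℂ) :
    ∑ i ∈ S, (f i).map g = (∑ i ∈ S, f i).map g := by
  change ∑ i ∈ S, Multiset.mapAddMonoidHom g (f i) = Multiset.mapAddMonoidHom g (∑ i ∈ S, f i)
  exact (map_sum _ _ _).symm

/-- **Henniart's identity is invariant under a common twist of the two infinity types**: shifting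
every exponent by `s` on both sides, `(T_P σ).map a = ∑_{σ' ∣ σ} (T_π σ').map a` holds for
`(T_P, T_π)` iff it holds for `(T_P.twist s, T_π.twist s)`. [cite: BuzzardGee2014, §3.1] -/
theorem map_a_eq_sum_iff_twist (TP : InfinityType K N) (Tπ : InfinityType L n) (s : ℂ)
    (σ : K →+* ℂ) [Fintype (L →+* ℂ)] :
    ((TP σ).map ArchWeight.a =
        ∑ σ' ∈ Finset.univ.filter (fun σ' : L →+* ℂ => σ'.comp (algebraMap K L) = σ),
          (Tπ σ').map ArchWeight.a) ↔
      ((TP.twist s σ).map ArchWeight.a =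
        ∑ σ' ∈ Finset.univ.filter (fun σ' : L →+* ℂ => σ'.comp (algebraMap K L) = σ),
          (Tπ.twist s σ').map ArchWeight.a) := by
  simp only [InfinityType.map_a_twist]
  rw [sum_map_eq_map_sum]
  exact ⟨fun h => by rw [h], fun h => Multiset.map_injective (add_left_injective s) h⟩

end Shift

/-! ### The instance of Henniart's statement is invariant under `(P, π) ↦ (P ⊗ |det|^s, π ⊗ |det|^s)` -/

section Instance

variable {K : Type} [Field K] [NumberField K] {L : Type} [Field L] [NumberField L] [Algebra K L]
  {N n : ℕ} {hK : isCompact_glFiniteIntegralLevel N K} {hL : isCompact_glFiniteIntegralLevel n L}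

/-- **One direction of the transfer.** If Henniart's conclusion holds for `(P, π)` — for all their
infinity types — then it holds for the twists `(P ⊗ |det|_K^s, π ⊗ |det|_L^s)`, `s` real: an
infinity type of a twist, twisted back by `-s`, is an infinity type of the original
(`HasInfinityType.of_map_mulChar_detTwist` for `|det|^{-s}`), and the identity is shift-invariant
(`map_a_eq_sum_iff_twist`). [cite: Henniart2012, §1.18] [cite: BorelJacquet1979, 5.7] -/
theorem henniartConclusion_normTwist {s : ℝ} {χK : HeckeCharacter K} {χL : HeckeCharacter L}
    (hχK : ∀ x : ideleGroup K,
      ((χK x : ℂˣ) : ℂ) = (GaloisRepresentations.ideleNorm x : ℂ) ^ ((s : ℝ) : ℂ))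
    (hχL : ∀ y : ideleGroup L,
      ((χL y : ℂˣ) : ℂ) = (GaloisRepresentations.ideleNorm y : ℂ) ^ ((s : ℝ) : ℂ))
    {P P' : AutomorphicRepData (AutomorphyDatum.gl N K hK)}
    (hPW : P'.W = P.W.map (mulChar (detTwist N χK)))
    (hPW' : P'.W' = P.W'.map (mulChar (detTwist N χK)))
    {π π' : AutomorphicRepData (AutomorphyDatum.gl n L hL)}
    (hπW : π'.W = π.W.map (mulChar (detTwist n χL)))
    (hπW' : π'.W' = π.W'.map (mulChar (detTwist n χL)))
    (h : ∀ (TP : InfinityType K N) (Tπ : InfinityType L n),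
      P.HasInfinityType TP → π.HasInfinityType Tπ → ∀ σ : K →+* ℂ,
        (TP σ).map ArchWeight.a =
          ∑ σ' ∈ Finset.univ.filter (fun σ' : L →+* ℂ => σ'.comp (algebraMap K L) = σ),
            (Tπ σ').map ArchWeight.a)
    (TP : InfinityType K N) (Tπ : InfinityType L n) (hTP : P'.HasInfinityType TP)
    (hTπ : π'.HasInfinityType Tπ) (σ : K →+* ℂ) :
    (TP σ).map ArchWeight.a =
      ∑ σ' ∈ Finset.univ.filter (fun σ' : L →+* ℂ => σ'.comp (algebraMap K L) = σ),
        (Tπ σ').map ArchWeight.a := by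
  -- the inverse twists `P = P' ⊗ |det|^{-s}`, `π = π' ⊗ |det|^{-s}`
  have hχK' : ∀ x : ideleGroup K, ((χK⁻¹ x : ℂˣ) : ℂ) =
      (GaloisRepresentations.ideleNorm x : ℂ) ^ (((-s : ℝ) : ℝ) : ℂ) := fun x => by
    rw [inv_apply_of_cpow hχK, Complex.ofReal_neg]
  have hχL' : ∀ y : ideleGroup L, ((χL⁻¹ y : ℂˣ) : ℂ) =
      (GaloisRepresentations.ideleNorm y : ℂ) ^ (((-s : ℝ) : ℝ) : ℂ) := fun y => by
    rw [inv_apply_of_cpow hχL, Complex.ofReal_neg]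
  have hPinvW : P.W = P'.W.map (mulChar (detTwist N χK⁻¹)) := by
    rw [detTwist_inv, hPW, map_mulChar_inv_map_mulChar]
  have hPinvW' : P.W' = P'.W'.map (mulChar (detTwist N χK⁻¹)) := by
    rw [detTwist_inv, hPW', map_mulChar_inv_map_mulChar]
  have hπinvW : π.W = π'.W.map (mulChar (detTwist n χL⁻¹)) := by
    rw [detTwist_inv, hπW, map_mulChar_inv_map_mulChar]
  have hπinvW' : π.W' = π'.W'.map (mulChar (detTwist n χL⁻¹)) := by
    rw [detTwist_inv, hπW', map_mulChar_inv_map_mulChar]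
  have hTP₀ : P.HasInfinityType (TP.twist ((-s : ℝ) : ℂ)) :=
    AutomorphicRepData.HasInfinityType.of_map_mulChar_detTwist hχK' hPinvW hPinvW' hTP
  have hTπ₀ : π.HasInfinityType (Tπ.twist ((-s : ℝ) : ℂ)) :=
    AutomorphicRepData.HasInfinityType.of_map_mulChar_detTwist hχL' hπinvW hπinvW' hTπ
  have h₀ := h _ _ hTP₀ hTπ₀ σ
  rw [← map_a_eq_sum_iff_twist] at h₀
  exact h₀

/-- **The instance of Henniart's statement for `(P, π)` is equivalent to its instance for the
twists `(P ⊗ |det|_K^s, π ⊗ |det|_L^s)`** (`s` real; hypothesis by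
`IsAutomorphicInductionAlong.of_normTwist`, conclusion by `henniartConclusion_normTwist`, both
ways). This is the reduction "on se ramène au cas unitaire" for the named fact
`Henniart2012_infinityType_of_automorphicInduction` (stated there for all cuspidal data; see its
module docstring), whose restatement along `IsAutomorphicInductionAlong` is
`Henniart2012_infinityType_of_automorphicInduction_iff_along`.
[cite: Henniart2012, §1.18] [cite: ArthurClozelAMS120, Ch. 3, proof of Thm. 3.1] -/
theorem henniartInstance_iff_normTwist {s : ℝ} {χK : HeckeCharacter K} {χL : HeckeCharacter L}
    (hχK : ∀ x : ideleGroup K,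
      ((χK x : ℂˣ) : ℂ) = (GaloisRepresentations.ideleNorm x : ℂ) ^ ((s : ℝ) : ℂ))
    (hχL : ∀ y : ideleGroup L,
      ((χL y : ℂˣ) : ℂ) = (GaloisRepresentations.ideleNorm y : ℂ) ^ ((s : ℝ) : ℂ))
    {P P' : AutomorphicRepData (AutomorphyDatum.gl N K hK)}
    (hPW : P'.W = P.W.map (mulChar (detTwist N χK)))
    (hPW' : P'.W' = P.W'.map (mulChar (detTwist N χK)))
    {π π' : AutomorphicRepData (AutomorphyDatum.gl n L hL)}
    (hπW : π'.W = π.W.map (mulChar (detTwist n χL)))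
    (hπW' : π'.W' = π.W'.map (mulChar (detTwist n χL))) :
    (IsAutomorphicInductionAlong π P → ∀ (TP : InfinityType K N) (Tπ : InfinityType L n),
      P.HasInfinityType TP → π.HasInfinityType Tπ → ∀ σ : K →+* ℂ,
        (TP σ).map ArchWeight.a =
          ∑ σ' ∈ Finset.univ.filter (fun σ' : L →+* ℂ => σ'.comp (algebraMap K L) = σ),
            (Tπ σ').map ArchWeight.a) ↔
    (IsAutomorphicInductionAlong π' P' → ∀ (TP : InfinityType K N) (Tπ : InfinityType L n),
      P'.HasInfinityType TP → π'.HasInfinityType Tπ → ∀ σ : K →+* ℂ,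
        (TP σ).map ArchWeight.a =
          ∑ σ' ∈ Finset.univ.filter (fun σ' : L →+* ℂ => σ'.comp (algebraMap K L) = σ),
            (Tπ σ').map ArchWeight.a) := by
  -- the inverse twists
  have hχK' : ∀ x : ideleGroup K, ((χK⁻¹ x : ℂˣ) : ℂ) =
      (GaloisRepresentations.ideleNorm x : ℂ) ^ (((-s : ℝ) : ℝ) : ℂ) := fun x => by
    rw [inv_apply_of_cpow hχK, Complex.ofReal_neg]
  have hχL' : ∀ y : ideleGroup L, ((χL⁻¹ y : ℂˣ) : ℂ) =
      (GaloisRepresentations.ideleNorm y : ℂ) ^ (((-s : ℝ) : ℝ) : ℂ) := fun y => by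
    rw [inv_apply_of_cpow hχL, Complex.ofReal_neg]
  have hPinvW : P.W = P'.W.map (mulChar (detTwist N χK⁻¹)) := by
    rw [detTwist_inv, hPW, map_mulChar_inv_map_mulChar]
  have hPinvW' : P.W' = P'.W'.map (mulChar (detTwist N χK⁻¹)) := by
    rw [detTwist_inv, hPW', map_mulChar_inv_map_mulChar]
  have hπinvW : π.W = π'.W.map (mulChar (detTwist n χL⁻¹)) := by
    rw [detTwist_inv, hπW, map_mulChar_inv_map_mulChar]
  have hπinvW' : π.W' = π'.W'.map (mulChar (detTwist n χL⁻¹)) := by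
    rw [detTwist_inv, hπW', map_mulChar_inv_map_mulChar]
  constructor
  · intro h hAI'
    exact henniartConclusion_normTwist hχK hχL hPW hPW' hπW hπW'
      (h (hAI'.of_normTwist hχK' hχL' hπinvW hπinvW' hPinvW hPinvW'))
  · intro h hAI
    exact henniartConclusion_normTwist hχK' hχL' hPinvW hPinvW' hπinvW hπinvW'
      (h (hAI.of_normTwist hχK hχL hπW hπW' hPW hPW'))

end Instance

end Literature.NumberTheory.Automorphic
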